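import Mathlib
import Summits.AnomalousDissipation.AnomalousDissipation.Theses.DyadicWallCascade
import Summits.AnomalousDissipation.AnomalousDissipation.Theorems.HalfSpaceHierarchy.Negative.ConstantHead
import Summits.AnomalousDissipation.AnomalousDissipation.Theorems.HalfSpaceHierarchy.Negative.Reversible
import Summits.AnomalousDissipation.AnomalousDissipation.Theorems.HalfSpaceHierarchy.Negative.Analytic
import Summits.AnomalousDissipation.AnomalousDissipation.Theorems.HalfSpaceHierarchy.Negative.Columnar
import Summits.AnomalousDissipation.AnomalousDissipation.Theorems.HalfSpaceHierarchy.Negative.OneSigned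

/-!
# Disproof of `HalfSpaceHierarchy` — findings (cdisprove seat, cycle 1, 2026-08-17)

Crux `DyadicWallCascade.HalfSpaceHierarchy` (stmt-AnomalousDissipation-18627): ∃ bounded `C^∞` steady
Euler `(V, Q)` on the open half-space `H = {z > 0}`, `V (2X) = V X`, `Q (2X) = Q X`, 1-periodic in
`x, y` on the band `1 ≤ z ≤ 2`, zero mass flux and energy flux `F ≠ 0` through `[0,1]² × {1}`.

VERDICT OF THIS CYCLE: **no kill**.  The crux is an `∃`-statement whose only content is `F ≠ 0`
(§A); every cheap obstruction (averaged conservation laws by degree, first-integral bookkeeping,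
the 2-D stream-function contraction) is either consistent or genuinely 2-dimensional (§E); what is
refutable are NATURAL STRENGTHENINGS, and seven of them are now theorems (§C, five files LANDED
under `Theorems/HalfSpaceHierarchy/Negative/`, a sixth — pressureless — submitted).  A disproof of the crux itself needs a Grad-type
rigidity theorem for smooth 3-D steady Euler flows with non-constant head (census N5) — open.

INDEX
* §A  load-bearing analysis (`∃`-crux: which conjunct carries content) — `without_fluxNonzero_inhabited`
      (rest state), `without_zeroMassFlux_inhabited` (uniform stream, `F = 1/2`): PROVED here.
* §B  tightness of the landed lemmas — the uniform stream is constant-head, irrotational, analytic: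
      every landed negative lemma USES the zero-mass-flux clause and is void without it (§A witness).
* §C  natural strengthenings refuted —
      LANDED  `Theorems.not_constantHeadHalfSpaceHierarchy`   (p146415, Negative/ConstantHead.lean)
      LANDED  `Theorems.not_irrotationalHalfSpaceHierarchy`   (p146415, idem)            = ¬ census S⁺₁
      LANDED  `Theorems.not_halfTurnReversibleHalfSpaceHierarchy` (p146536, Negative/Reversible.lean) = ¬ S⁺₃
      LANDED  `Theorems.not_analyticHalfSpaceHierarchy`       (p146781, Negative/Analytic.lean)  ⊇ ¬ S⁺₂
      LANDED  `Theorems.not_columnarHalfSpaceHierarchy`       (p146880, Negative/Columnar.lean)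
      LANDED  `Theorems.not_oneSignedFluxHalfSpaceHierarchy`  (p146990, Negative/OneSigned.lean) = census T1(ii)
      PENDING `Theorems.not_pressurelessHalfSpaceHierarchy` (p147505, Negative/Pressureless.lean): crux ∧
              `∇Q = 0` is false — the FIRST obstruction here that uses the expanding map `x ↦ 2x`
              (free streaming ⇒ a descending velocity value's level set on `{z=1}` is stable under the
              four inverse branches `q ↦ (q+P+n)/2`, hence dense, hence everything ⇒ mass flux ≠ 0)
      SORRY   `not_xIndependentHalfSpaceHierarchy` (2½-D; complete paper proof in the docstring —
              dynamical, not formalised: flow maps + area preservation)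
* §D  targets — none broken: the 7 stubs of line `Sketch` are TRUE as typed (list + reasons below).
* §E  why it resists — docstring `resists`: degree bookkeeping; a KINEMATIC counterexample showing
      that no obstruction using only "head is a first integral" can work in 3-D; the 2-D kill and
      where its 3-D lift breaks (curtain argument fails exactly at perimeter-doubling); one new
      necessary condition for rest-fluid / compact-cross-section designs (zero angular-momentum
      flux per leg tree, degree +1).
-/

set_option linter.dupNamespace false
set_option linter.unusedVariables false

noncomputable section

open scoped BigOperators Topology InnerProductSpace
open Filter Set MeasureTheory
open Summit.AnomalousDissipation.AnomalousDissipation.Theses.DyadicWallCascade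

namespace Summit.AnomalousDissipation.AnomalousDissipation.Cruxes.HalfSpaceHierarchy.Disproof

/-! ## §0 The crux body as a predicate (verbatim; = `StrategyCensus.Body` of CensusSignatures.lean) -/

/-- The crux clause block with the two flux clauses exposed as parameters `massOK`, `fluxOK` (so that
single clauses can be dropped) and one extra clause `extra V Q`. `Body' (· = 0) (fun F _ => F ≠ 0) extra`
is the census `Body extra`. -/
def Body' (massOK : ℝ → Prop) (fluxOK : ℝ → ℝ → Prop)
    (extra : (EuclideanSpace ℝ (Fin 3) → EuclideanSpace ℝ (Fin 3)) → (EuclideanSpace ℝ (Fin 3) → ℝ) → Prop) :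
    Prop :=
  ∃ (V : EuclideanSpace ℝ (Fin 3) → EuclideanSpace ℝ (Fin 3)) (Q : EuclideanSpace ℝ (Fin 3) → ℝ) (C F : ℝ),
    (let H : Set (EuclideanSpace ℝ (Fin 3)) := {X | 0 < X 2}
     let e : Fin 3 → EuclideanSpace ℝ (Fin 3) := fun i => EuclideanSpace.single i (1 : ℝ)
     let pt : ℝ × ℝ → EuclideanSpace ℝ (Fin 3) := fun q => !₂[q.1, q.2, (1 : ℝ)]
     ContDiffOn ℝ ((⊤ : ℕ∞) : WithTop ℕ∞) V H ∧ ContDiffOn ℝ ((⊤ : ℕ∞) : WithTop ℕ∞) Q H ∧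
     (∀ X ∈ H, ‖V X‖ ≤ C ∧ |Q X| ≤ C) ∧ (∀ X ∈ H, ∑ i : Fin 3, (fderiv ℝ V X (e i)) i = 0) ∧
     (∀ X ∈ H, (fderiv ℝ V X) (V X) + gradient Q X = 0) ∧
     (∀ X ∈ H, V ((2 : ℝ) • X) = V X ∧ Q ((2 : ℝ) • X) = Q X) ∧
     (∀ X : EuclideanSpace ℝ (Fin 3), 1 ≤ X 2 → X 2 ≤ 2 →
        V (X + e 0) = V X ∧ V (X + e 1) = V X ∧ Q (X + e 0) = Q X ∧ Q (X + e 1) = Q X) ∧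
     massOK (∫ q in Set.Icc (0 : ℝ) 1 ×ˢ Set.Icc (0 : ℝ) 1, (V (pt q)) 2) ∧ fluxOK F
       (∫ q in Set.Icc (0 : ℝ) 1 ×ˢ Set.Icc (0 : ℝ) 1, (V (pt q)) 2) ∧
     (∫ q in Set.Icc (0 : ℝ) 1 ×ˢ Set.Icc (0 : ℝ) 1, (V (pt q)) 2 * (‖V (pt q)‖ ^ 2 / 2 + Q (pt q)) = F)) ∧
    extra V Q

/-- The crux is `Body'` with the genuine flux clauses and no extra clause. -/
theorem crux_iff : HalfSpaceHierarchy ↔ Body' (· = 0) (fun F _ => F ≠ 0) (fun _ _ => True) := by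
  constructor
  · rintro ⟨V, Q, C, F, h⟩
    simp only at h
    obtain ⟨h1, h2, h3, h4, h5, h6, h7, h8, h9, h10⟩ := h
    exact ⟨V, Q, C, F, ⟨h1, h2, h3, h4, h5, h6, h7, h8, h9, h10⟩, trivial⟩
  · rintro ⟨V, Q, C, F, h, -⟩
    simp only at h
    obtain ⟨h1, h2, h3, h4, h5, h6, h7, h8, h9, h10⟩ := h
    exact ⟨V, Q, C, F, ⟨h1, h2, h3, h4, h5, h6, h7, h8, h9, h10⟩⟩

/-! ## §A Load-bearing analysis — the content is exactly `F ≠ 0`, normalised by zero mass flux -/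

/-- A constant field with constant pressure satisfies every pointwise clause of the crux. -/
theorem const_clauses (v : EuclideanSpace ℝ (Fin 3)) (c : ℝ) :
    let H : Set (EuclideanSpace ℝ (Fin 3)) := {X | 0 < X 2}
    let e : Fin 3 → EuclideanSpace ℝ (Fin 3) := fun i => EuclideanSpace.single i (1 : ℝ)
    ContDiffOn ℝ ((⊤ : ℕ∞) : WithTop ℕ∞) (fun _ : EuclideanSpace ℝ (Fin 3) => v) H ∧
    ContDiffOn ℝ ((⊤ : ℕ∞) : WithTop ℕ∞) (fun _ : EuclideanSpace ℝ (Fin 3) => c) H ∧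
    (∀ X ∈ H, ‖(fun _ : EuclideanSpace ℝ (Fin 3) => v) X‖ ≤ ‖v‖ + |c| ∧
      |(fun _ : EuclideanSpace ℝ (Fin 3) => c) X| ≤ ‖v‖ + |c|) ∧
    (∀ X ∈ H, ∑ i : Fin 3, (fderiv ℝ (fun _ : EuclideanSpace ℝ (Fin 3) => v) X (e i)) i = 0) ∧
    (∀ X ∈ H, (fderiv ℝ (fun _ : EuclideanSpace ℝ (Fin 3) => v) X) ((fun _ => v) X)
      + gradient (fun _ : EuclideanSpace ℝ (Fin 3) => c) X = 0) ∧
    (∀ X ∈ H, (fun _ : EuclideanSpace ℝ (Fin 3) => v) ((2 : ℝ) • X) = (fun _ => v) X ∧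
      (fun _ : EuclideanSpace ℝ (Fin 3) => c) ((2 : ℝ) • X) = (fun _ => c) X) ∧
    (∀ X : EuclideanSpace ℝ (Fin 3), 1 ≤ X 2 → X 2 ≤ 2 →
      (fun _ : EuclideanSpace ℝ (Fin 3) => v) (X + e 0) = (fun _ => v) X ∧
      (fun _ : EuclideanSpace ℝ (Fin 3) => v) (X + e 1) = (fun _ => v) X ∧
      (fun _ : EuclideanSpace ℝ (Fin 3) => c) (X + e 0) = (fun _ => c) X ∧
      (fun _ : EuclideanSpace ℝ (Fin 3) => c) (X + e 1) = (fun _ => c) X) := by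
  simp only
  refine ⟨contDiffOn_const, contDiffOn_const, ?_, ?_, ?_, ?_, ?_⟩
  · intro X _; constructor
    · exact le_add_of_nonneg_right (abs_nonneg c)
    · exact le_add_of_nonneg_left (norm_nonneg v)
  · intro X _; simp
  · intro X _
    have : gradient (fun _ : EuclideanSpace ℝ (Fin 3) => c) X = 0 := by
      rw [gradient, fderiv_const_apply]; simp
    simp [this]
  · intro X _; simp
  · intro X _ _; simp

/-- **Drop `F ≠ 0` ⇒ inhabited by the rest state** (`V ≡ 0`, `Q ≡ 0`, `F = 0`).  So the conjunction
of all other clauses (smooth, bounded, div-free, Euler, DSS, band-periodic, zero mass flux, energy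
flux `= F`) carries no content by itself. -/
theorem without_fluxNonzero_inhabited : Body' (· = 0) (fun _ _ => True) (fun _ _ => True) := by
  refine ⟨fun _ => 0, fun _ => 0, ‖(0 : EuclideanSpace ℝ (Fin 3))‖ + |(0:ℝ)|, 0, ?_, trivial⟩
  have hc := const_clauses (0 : EuclideanSpace ℝ (Fin 3)) 0
  simp only at hc ⊢
  obtain ⟨h1, h2, h3, h4, h5, h6, h7⟩ := hc
  refine ⟨h1, h2, h3, h4, h5, h6, h7, by simp, trivial, by simp⟩

/-- **Drop zero mass flux ⇒ inhabited by the uniform stream** `V ≡ e₂ = (0,0,1)`, `Q ≡ 0`, with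
`F = ∫ 1 · (1/2 + 0) = 1/2 ≠ 0`.  So the zero-mass-flux clause is the load-bearing NORMALISATION
(it also fixes the gauge `Q ↦ Q + c`, which shifts `F` by `c ∫ V₃`): every refutation of a
strengthening below goes through it. -/
theorem without_zeroMassFlux_inhabited : Body' (fun _ => True) (fun F _ => F ≠ 0) (fun _ _ => True) := by
  refine ⟨fun _ => EuclideanSpace.single 2 1, fun _ => 0,
    ‖(EuclideanSpace.single (2 : Fin 3) (1 : ℝ))‖ + |(0:ℝ)|, 1 / 2, ?_, trivial⟩
  have hc := const_clauses (EuclideanSpace.single (2 : Fin 3) (1 : ℝ)) 0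
  simp only at hc ⊢
  obtain ⟨h1, h2, h3, h4, h5, h6, h7⟩ := hc
  refine ⟨h1, h2, h3, h4, h5, h6, h7, trivial, by norm_num, ?_⟩
  have hn : ‖EuclideanSpace.single (2 : Fin 3) (1 : ℝ)‖ = 1 := by simp
  simp only [PiLp.single_apply, if_true, hn, one_pow, add_zero, one_mul]
  rw [setIntegral_const, Summit.AnomalousDissipation.AnomalousDissipation.Theorems.HalfSpaceHierarchyNegative.volReal_unitSq]
  norm_num

/-! ## §B Tightness of the landed negative lemmas

The uniform stream of `without_zeroMassFlux_inhabited` has CONSTANT head `1/2`, is irrotational and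
real-analytic, and carries `F = 1/2 ≠ 0`: so `not_constantHeadHalfSpaceHierarchy`,
`not_irrotationalHalfSpaceHierarchy`, `not_analyticHalfSpaceHierarchy` are void without the
zero-mass-flux clause — each of them is really a statement about the NORMALISED flux
`F − B̄ · (mass flux)`.  (The reversible lemma instead dies without band periodicity at height 1: the
half-turn maps `[0,1]²` to `[-1,0]²`.)  Nothing to prove beyond §A. -/

/-! ## §C Natural strengthenings refuted -/

/-- ¬ S⁺₁ (census `IrrotationalHierarchy`), from the landed file `Negative/ConstantHead.lean`. -/
theorem not_irrotational :
    ¬ Body' (· = 0) (fun F _ => F ≠ 0) (fun V _ => ∀ X : EuclideanSpace ℝ (Fin 3), 0 < X 2 → ∀ i j : Fin 3,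
      (fderiv ℝ V X (EuclideanSpace.single i (1 : ℝ))) j = (fderiv ℝ V X (EuclideanSpace.single j (1 : ℝ))) i) := by
  rintro ⟨V, Q, C, F, h, hx⟩
  exact Summit.AnomalousDissipation.AnomalousDissipation.Theorems.not_irrotationalHalfSpaceHierarchy
    ⟨V, Q, C, F, h, hx⟩

/-- ¬ (crux ∧ constant head on `H`) — kills every potential AND every Beltrami design. Landed. -/
theorem not_constantHead :
    ¬ Body' (· = 0) (fun F _ => F ≠ 0) (fun V Q => ∀ X : EuclideanSpace ℝ (Fin 3), 0 < X 2 →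
      ∀ Y : EuclideanSpace ℝ (Fin 3), 0 < Y 2 → ‖V X‖ ^ 2 / 2 + Q X = ‖V Y‖ ^ 2 / 2 + Q Y) := by
  rintro ⟨V, Q, C, F, h, hx⟩
  exact Summit.AnomalousDissipation.AnomalousDissipation.Theorems.not_constantHeadHalfSpaceHierarchy
    ⟨V, Q, C, F, h, hx⟩

/-- ¬ S⁺₃ (census `HalfTurnReversibleHierarchy`), from the landed file `Negative/Reversible.lean`:
`F` is odd under every reversing lattice isometry preserving the planes — Lortz-type closed-line
schemes cannot produce a witness. -/
theorem not_halfTurnReversible :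
    ¬ Body' (· = 0) (fun F _ => F ≠ 0) (fun V Q => ∀ X : EuclideanSpace ℝ (Fin 3),
      V (!₂[-(X 0), -(X 1), X 2]) = !₂[(V X) 0, (V X) 1, -((V X) 2)] ∧ Q (!₂[-(X 0), -(X 1), X 2]) = Q X) := by
  rintro ⟨V, Q, C, F, h, hx⟩
  exact Summit.AnomalousDissipation.AnomalousDissipation.Theorems.not_halfTurnReversibleHalfSpaceHierarchy
    ⟨V, Q, C, F, h, hx⟩

/-- ¬ (crux ∧ `V` real-analytic on the half-space) ⊇ ¬ S⁺₂ (census `AnalyticHierarchy`), from the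
landed file `Negative/Analytic.lean`: band periods spread by the identity principle, dilation gives
all dyadic periods, the `z = 1` trace is horizontally constant, `F = 0`.  Every witness is flat-glued. -/
theorem not_analytic :
    ¬ Body' (· = 0) (fun F _ => F ≠ 0) (fun V _ => AnalyticOnNhd ℝ V {X : EuclideanSpace ℝ (Fin 3) | 0 < X 2}) := by
  rintro ⟨V, Q, C, F, h, hx⟩
  exact Summit.AnomalousDissipation.AnomalousDissipation.Theorems.not_analyticHalfSpaceHierarchy
    ⟨V, Q, C, F, h, hx⟩

/-- **No columnar (z-independent) witness**, from the landed file `Negative/Columnar.lean`.  If `V`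
does not depend on `z`, dilation invariance makes the trace `W(q) = V(q, 1)` satisfy
`W(q) = W(q/2) = … = W(q/2^k) → W(0)`, so the trace is constant (continuity at ONE interior point
suffices — no periodicity needed), zero mass flux kills its vertical component and `F = 0`.  Note
that columnar jets `w(x,y) e₂` DO carry `F = ½∫w³ ≠ 0` with zero mass flux — what kills them is only
the self-similarity. -/
theorem not_columnar :
    ¬ Body' (· = 0) (fun F _ => F ≠ 0) (fun V _ => ∀ X Y : EuclideanSpace ℝ (Fin 3), 0 < X 2 → 0 < Y 2 →
      X 0 = Y 0 → X 1 = Y 1 → V X = V Y) := by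
  rintro ⟨V, Q, C, F, h, hx⟩
  exact Summit.AnomalousDissipation.AnomalousDissipation.Theorems.not_columnarHalfSpaceHierarchy
    ⟨V, Q, C, F, h, hx⟩

/-- **No one-signed through-flow** (census T1 (ii) as a theorem), from the landed file
`Negative/OneSigned.lean`: with zero mass flux, `V₃ ≥ 0` on the flux square gives
`|F| ≤ (C²/2 + C) ∫ V₃ = 0`.  Every witness has up- AND down-going fluid through the unit square of
every plane: no lattice-periodic transverse section, no inflow face for Alber/Buffoni–Wahlén schemes. -/
theorem not_oneSigned :
    ¬ Body' (· = 0) (fun F _ => F ≠ 0) (fun V _ => ∀ q : ℝ × ℝ, q ∈ Set.Icc (0 : ℝ) 1 ×ˢ Set.Icc (0 : ℝ) 1 →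
      0 ≤ (V !₂[q.1, q.2, (1 : ℝ)]) 2) := by
  rintro ⟨V, Q, C, F, h, hx⟩
  exact Summit.AnomalousDissipation.AnomalousDissipation.Theorems.not_oneSignedFluxHalfSpaceHierarchy
    ⟨V, Q, C, F, h, hx⟩

/- **No pressureless witness** — SUBMITTED as
`Summit.AnomalousDissipation.AnomalousDissipation.Theorems.not_pressurelessHalfSpaceHierarchy`
(p147505, `Negative/Pressureless.lean`, rc 0 / 0 sorry in this seat's folder): extra clause
`∀ X, 0 < X 2 → gradient Q X = 0`.  Mechanism (the only one so far that turns the doubling map into an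
obstruction): Grönwall makes `V` constant on backward rays (`freeStream_const_backward`); for a
descending velocity value `v` on `{z = 1}` the closed level set `{q : V(q,1) = v}` is stable under
`q ↦ (q + v_h/v₃ + n)/2`, `n ∈ ℤ²` (ray to height 2, integer shift, halve), so it contains a
translate of every `2^{-k}ℤ²` and is the whole plane — mass flux `v₃ ≠ 0`, contradiction; with no
descending point, `not_oneSigned` applies.  The alias will be added here once the module is built on
the farm; import `…Negative.Pressureless` directly meanwhile. -/

/-- **2½-D (x-independent) witnesses do not exist** — NEAR-MISS (not formalised; complete paper
proof here, dynamical).  Extra clause: `V (X + t • e₀) = V X` for all `t`.  Write `V = (u, v, w)(y, z)`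
on the half-plane `P = {z > 0}`; `v_y + w_z = 0` gives a stream function `ψ` (`v = ψ_z`, `w = -ψ_y`),
normalised (adding a constant) so that `ψ(2Y) = 2ψ(Y)`; zero mass flux makes `ψ` 1-periodic in `y`
for `z ≤ 2`; `|∇ψ| ≤ C` and homogeneity give `|ψ(y, z)| ≤ M z` (M = max of |ψ| on the band).
First integrals of the planar flow `(v, w)`: `u` (transport), `B = |V|²/2 + Q` (Bernoulli).
CLAIM: for every bounded smooth first integral `h` of degree 0, `∫₀¹ w h dy = 0` at `z = 1`; with
`h = B` this is `F = 0`.  PROOF. Split the down-crossings of `{z = 1}` (w < 0) by the fate of their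
streamline (= component of a level set of `ψ`, traversed with bounded speed, in the cylinder
`(ℝ/ℤ) × (0, 1]`): (i) returns to `{z = 1}`; (ii) never returns and `inf z > 0`; (iii) never returns
and `inf z = 0`.  (ii) carries zero flux: for each `c > 0` the streamlines trapped forever in
`(ℝ/ℤ) × [c, 1]` sweep, in time `T`, an area `= T ·`(their flux) inside a region of area `≤ 1`
(area preservation), so their flux is `0`; take `c = 1/n ↓ 0`.  (iii) carries zero flux: along such
a streamline `ψ` is constant and `|ψ| ≤ M z → 0` along a sequence, so `ψ = 0` on it; these
down-crossings lie in `Z = {y : ψ(y, 1) = 0}` and `∫_Z |ψ_y(y,1)| dy = 0` (the derivative of a `C¹`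
function vanishes at every non-isolated point of its zero set).  (i): the first-return map from
returning down-crossings to up-crossings preserves the flux measure `|w| dy` (Poincaré map of an
area-preserving flow) and `h` (first integral), so `∫_{(i)} h |w| dy = ∫_{returns} h |w| dy`.
Symmetrically (time reversed) every up-crossing either is such a return or carries zero flux.
Hence `∫₀¹ w h dy = -∫_{down} h|w| + ∫_{up} h|w| = 0`. ∎  WHY NOT IN LEAN: needs the global flow of
a bounded smooth planar field, Liouville's theorem for it and a first-return map — none of which is
a one-session formalisation.  WHY IT DOES NOT LIFT TO 3-D: see `resists`, item 3. -/
theorem not_xIndependentHalfSpaceHierarchy :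
    ¬ Body' (· = 0) (fun F _ => F ≠ 0) (fun V Q => ∀ (X : EuclideanSpace ℝ (Fin 3)) (t : ℝ), 0 < X 2 →
      V (X + t • EuclideanSpace.single 0 1) = V X ∧ Q (X + t • EuclideanSpace.single 0 1) = Q X) := by
  sorry

/-! ## §D Targets (the lead's stubs, line `Sketch`, skeleton af723686…) — none is false

Checked on paper 2026-08-17 (payload `stuck_stubs = []`; no `stub_*_false` to file):
* `stub_slabProfile` — IS the crux on the slab `1/2 < z < 4` (census `halfSpace_to_slab` proves the
  converse direction); not attackable short of the crux.
* `stub_slabExtension` — TRUE: `Ṽ X := V (2^{-k} X)` on `2^k ≤ z < 2^{k+1}` agrees with `V ∘ (2^{-k}•)`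
  on the open sub-slab `2^{k-1} < z < 2^{k+2}` by the slab dilation clause, so `C^∞`, divergence,
  Euler (both scale by `2^{-k}`), bounds, flux clauses all transfer.
* `stub_curlOfDegreeZeroField` — TRUE: `V ∘ (2•) = V` on the open `H`, so
  `2 • DV(2X) = D(V ∘ (2•))(X) = DV(X)` (chain rule + `Filter.EventuallyEq.fderiv_eq`), and `curl` is
  linear in `DV` with the standard index convention of `VectorCalculus.curl`.
* `stub_fluxQuadruplesPerOctave` — TRUE and unconditional (linear change of variables `q ↦ 2q` in
  `ℝ²`, `Measure.integral_comp_smul`; continuity is not even needed).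
* `stub_lambVectorIsBernoulliGradient` — TRUE: `VectorCalculus.cross`/`curl` carry the standard
  signs (`cross = Mathlib crossProduct`, `curl = (∂₁V₂−∂₂V₁, ∂₂V₀−∂₀V₂, ∂₀V₁−∂₁V₀)`), and
  `(V × curl V)ᵢ = Σⱼ Vⱼ(∂ᵢVⱼ − ∂ⱼVᵢ) = ∂ᵢ(‖V‖²/2) − ((V·∇)V)ᵢ`; `C¹` on an open set suffices.
* `stub_superCriticalMatchingInvertible` — TRUE (`A − wK = A(1 − wA⁻¹K)`, `‖wA⁻¹K‖ ≤ w‖A⁻¹‖ < 1`,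
  Neumann series; `‖K‖ ≤ 1`).
* `stub_subCriticalMatchingNotSurjective` — TRUE but Mathlib-hard: `wK − A` is bounded below by
  `w − ‖A‖ > 0`; by Kato's semi-Fredholm stability (Perturbation Theory IV §5.17/5.22, valid in Banach
  spaces, `γ(wK) = w > ‖A‖`) `ind(wK − A) = ind(wK) = −def K < 0` (or `−∞`), so it is not surjective.
  A prover without Fredholm theory can run the continuity argument of the stub's docstring only with
  an index-stability lemma; flag for the lead, not a kill.
-/

/-! ## §E Why the crux resists (for ideators / planners / the next disprover) -/

/-- `resists` — a `True` carrier for the analysis (prose lives in this docstring by house rule).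

1. DEGREE BOOKKEEPING IS EXHAUSTED.  A divergence-free current `J` with `J(2X) = 2^d J(X)` has
   per-area flux through `{z = h}` independent of `h` (lateral periodicity) and multiplied by `2^d`
   per octave, hence zero unless `d = 0`.  `d = 0` (FREE): mass `0`, momentum `⟨V₃V⟩ + ⟨Q⟩e₃`,
   energy `F`, and `⟨V₃ g(B)⟩` for every `g` (the flux-weighted head distribution `μ = B_*(V₃ dq)`,
   a signed measure with `∫dμ = 0`, `F = ∫ b dμ`).  `d = −1` (FORCED ZERO, design constraints):
   `⟨ω₃ g(B)⟩ = 0 ∀g`, `⟨(V₃ωᵢ − Vᵢω₃) g(B)⟩ = 0`, helicity flux.  `d = +1`: multipliers contain `X`,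
   not periodic; the shift-averaged virial closes to `⟨V₃² + Q⟩ = P₃` (trivial) and the census's
   dyadically-summed X-virial closes WITHOUT sign.  Nothing constrains `F`.
2. NO FIRST-INTEGRAL OBSTRUCTION EXISTS IN 3-D (kinematic counterexample).  There is a bounded
   `C^∞` divergence-free `V` on `H` with `V(2X) = V(X)`, band-periodic, zero mass flux, and a bounded
   `C^∞` degree-0 band-periodic FIRST INTEGRAL `B` (`V·∇B = 0`) with `⟨V₃ B⟩ ≠ 0`: take a descending
   tube tree `T_D` (one tube per cell in the band `[1,2]` branching smoothly 1 → 4 into the four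
   half-size tubes of the band `[1/2, 1]`; `T_D = 2T_D`, lattice periodic per band) and a disjoint
   ascending tree `T_A` (shifted by `(1/2, 1/2)` at the top level; tubes in `ℝ³` can be routed past
   each other), fill each with a smooth divergence-free field supported in the tube and carrying
   flux `∓m` (superpose smoothed endless filaments along an equivariant family of paths — endless
   tubes CAN carry flux, unlike compact blobs), put `V = 0` elsewhere, `B = 1` on `T_D`, `B = 0` on
   `T_A`, anything smooth equivariant in between.  Then `⟨V₃B⟩ = −m ≠ 0`.  Consequently ANY proof of
   `¬HalfSpaceHierarchy` must use the Euler equation beyond "the head is transported" — i.e. beyond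
   everything items 1–2 see.  (Euler is violated exactly at the tube walls: `B` const inside forces
   `V × ω = 0` there, and compactly supported Beltrami-type fields are trivial — which is why the
   planner needs vortex SHEATHS with a head jump, and the strategist's Grad-class verdict.)
3. THE 2-D KILL AND WHERE ITS LIFT BREAKS.  In 2-D (and 2½-D, `not_xIndependentHalfSpaceHierarchy`)
   the stream function has degree 1, so `ψ = O(z)`: wall-bound streamlines live in the single level
   `{ψ = 0}` and carry no flux.  The 3-D analogue of "ψ(X) = flux through the vertical segment under
   X" is the flux through the vertical CURTAIN under an arc `c` of wall-bound down-crossings; closing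
   the curtain against the stream surface of `c` needs the closing curtain under the transported arc
   `c_T` to have vanishing flux, i.e. `length(c_T) · height(c_T) → 0`.  Down one octave the height
   halves while the arc is stretched by the cascade; the planner's design stretches channel perimeter
   by EXACTLY ×2 per octave (vortex-sheath stretching is what regenerates `ω ~ 2^k`), so the estimate
   sits exactly at the borderline and gives nothing.  On regular Bernoulli leaves the commuting frame
   `(V, ω)` gives closed forms `ds, dt` with `δ^*dt = 4 dt` (ideator L5): the leafwise "stream
   function" `t` has degree 2 and `|dt| ~ z`, so `t → 0` at the wall along wall-bound lines IF `t`
   were single-valued on the leaf up to the wall — it is not (periods of `dt` = mass flux per unit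
   head across closed leaf curves / lattice identifications), and that multivaluedness is precisely
   the room the 3-D object lives in.
4. ONE NEW NECESSARY CONDITION for rest-fluid designs (card `slender-swirl-fission` and any design
   whose flux-carrying legs have compact cross-section inside fluid at rest, `V = 0`, `Q = Q₀`):
   x-weighted conservation laws become available per junction.  Angular-momentum flux about the
   vertical (`ξ = (−y, x, 0)` is Killing, `div(ξᵢTᵢⱼ) = 0`, `T = V⊗V + (Q−Q₀)I` vanishes in the rest
   fluid): through a closed surface around one junction, parent flux `L e₂` = Σ children
   `L_c t̂_c + r_c × (M_c t̂_c)`; exact half-scale copies have `L_c = L/8` (velocity same, lever and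
   area scale), momentumless legs (`M_c = 0`, needed for tilting, card §2) kill the transport term, so
   `|L| ≤ 4·|L|/8` ⇒ `L = 0`: EVERY LEG TREE HAS ZERO ANGULAR-MOMENTUM FLUX `∫ ρ v_θ w dA = 0`
   (degree +1 ⇒ forced zero, the rest fluid making the moment legitimate).  Likewise helicity flux per
   leg `= 0` (degree −1 per junction: `H = 4·H/2`).  With the X-virial (`div(xᵢTᵢⱼ) = |V|² + 3(Q−Q₀)`;
   columnar momentumless portions contribute `0` by the planar virial `∫(v_θ² + 2(Q−Q₀)) dA = 0`):
   `∫_{junction core} (|V|² + 3(Q − Q₀)) dX = 0`.  All three are satisfiable scalar constraints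
   (swirl with `w` changing sign across the core, pressure deficit `Q < Q₀`), not kills — recorded so
   that the card's "forced profile" list is complete: momentumless AND angular-momentumless AND
   helicity-free legs, virial-balanced junction cores.
5. LITERATURE NEGATIVES CHECKED (none instantiates): Shvydkoy 2018 homogeneous steady Euler
   (continuous dilations about a point: Prop 3.2/5.2 irrotational-only — needs the radial ODE from ALL
   dilations); Hamel–Nadirashvili (2-D); Chae–Constantin / Nadirashvili Beltrami Liouville (covered by
   `not_constantHead`); De Rosa–Inversi BV rigidity (witness is not BV: `∫|∇V| ~ ∫dz/z`);
   Bardos–Titi–Wiedemann / Drivas–Nguyen boundary energy conservation (need `V₃ → 0` strongly at the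
   wall; here `(1/ε)∫_{z<ε}⟨|V₃|³⟩ = ⟨|V₃|³⟩(1)` is constant by scaling — violated by design, consistent).
   `ledger negatives --problem AnomalousDissipation`: 6 entries, none within instantiation distance.
   Searches of this seat (2026-08-17 07:38Z) were degraded (local searchd reset, S2 429, OpenAlex
   budget exhausted, arXiv 0 rows; galaxy bm25/pdf 20 rows, only Khesin–Misiołek–Shnirelman
   arXiv:2205.01143 relevant) — the same-day searches of grounders g79-2…6 and the strategist stand.
6. SLAB-COLUMNAR DESIGNS (card `bernoulli-surface-topology`, `NoColumnarSlab`; my `not_columnar` is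
   its global special case).  Sanity check of the card's budget on the sharpest case, a PURE JET SLAB
   `V = (0, 0, w(x, y))`, `Q = q₀` on `a < z < b` (an exact steady Euler slab with `F = ½⟨w³⟩` free and
   every conservation law of item 1 satisfied — so only topology can kill it): Bernoulli surfaces in
   the slab are the vertical cylinders over level curves of `w`, with `V₃ = w` CONSTANT on each; for
   a.e. head `c` a compact piece of `{B = c}` between a cut in the slab and a cut in the half-scale
   slab below has a nowhere-zero tangent `V` transverse to all boundary circles, hence `χ = 0`
   (annuli); a top-to-bottom annulus ends on ONE component of the half-scale level set, so its flux
   `Φ` satisfies `Φ = Φ'/4` with `Φ'` among the finitely many fluxes enclosed by components of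
   `{w = w_c}` in a cell; iterating down the cascade forces a repetition `Φ = Φ/4^p`, i.e. `Φ = 0`:
   transiting tubes carry no flux, all slab fluid returns to its slab at equal head (top-to-top
   annuli pair down-jets with up-jets of the same speed), the flux-weighted head measures of up- and
   down-crossings coincide and `F = 0`.  So (modulo Sard/transversality genericity, as in the card)
   the budget's NoColumnarSlab reading is CONFIRMED on paper for jet slabs; not formalisable this
   cycle (Poincaré–Hopf with boundary, Sard, stream surfaces).
-/
theorem resists : True := trivial

end Summit.AnomalousDissipation.AnomalousDissipation.Cruxes.HalfSpaceHierarchy.Disproof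

end
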